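import Summits.KontsevichZagierPeriods.KontsevichZagierPeriods.Theorems.LinRedNormalFormArrangementNormalFormStubRebaseSimpleZeroProductTools

/-!
# Stub `stub_rebaseSimpleZero`, part `rebaseSimpleZero_product` (crux `ArrangementNormalForm`, line `janus-bands`, v6.2) — `Basic`

Basic facts on product representations over a one-dimensional base (`RebaseZero.IsProd`):
coordinate bounds and BOUNDEDNESS of a product domain over a bounded base cell
(`RebaseZero.isBounded_pDom`, registered as `rebaseSimpleZeroProduct_isBounded_pDom`), restriction
to product sub-domains, the closure properties of the target predicate `RebaseZero.Good`, the
PACKAGING lemma `RebaseZero.good_of_allFmt` (all fibres in format ⟹ literally in `GG 0 2 k`,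
`RebasePos.mem_GGset_two`) and the transfer of the continuation hypothesis `RebaseZero.HP` along
the spectators.

References: M. Kontsevich, D. Zagier, *Periods* (2001), §1.2.
-/

noncomputable section

open Set MeasureTheory MvPolynomial
open Literature.NumberTheory.Transcendental Literature.ModelTheory.ExponentialFields

namespace Summit.KontsevichZagierPeriods.ArrangementNormalForm.JanusBands

namespace RebaseZero

open SeparatePos RebasePos

variable {k : ℕ}

/-! ### Bounds -/

/-- `|α y + β| ≤ |α| |y| + |β|`. [folklore] -/
theorem abs_ev_le (c : Cf) (y : ℝ) : |ev c y| ≤ |(c.1 (Fin.last 0) : ℝ)| * |y| + |(c.2 : ℝ)| := by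
  unfold ev
  calc |(c.1 (Fin.last 0) : ℝ) * y + c.2| ≤ |(c.1 (Fin.last 0) : ℝ) * y| + |(c.2 : ℝ)| :=
        abs_add_le _ _
    _ = _ := by rw [abs_mul]

/-- `|ev c y|` is bounded on bounded sets of `y`. [folklore] -/
theorem abs_ev_le_of (c : Cf) {y R : ℝ} (h : |y| ≤ R) :
    |ev c y| ≤ |(c.1 (Fin.last 0) : ℝ)| * R + |(c.2 : ℝ)| :=
  (abs_ev_le c y).trans (by gcongr)

/-- Coordinate bounds on a product domain over a bounded base cell. [folklore] -/
theorem abs_le_of_mem_pDom {m' : ℕ} (M : Fin m' → Cf) (U V : Fin k → Cf) {R : ℝ}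
    (hR : ∀ y ∈ cell M, |y| ≤ R) {z : Fin (0 + 1 + k) → ℝ} (hz : z ∈ pDom M U V) :
    |yv z| ≤ R ∧ ∀ i, |tv z i| ≤ (|((U i).1 (Fin.last 0) : ℝ)| + |((V i).1 (Fin.last 0) : ℝ)|) * R +
      (|((U i).2 : ℝ)| + |((V i).2 : ℝ)|) := by
  rw [mem_pDom] at hz
  have hy := hR _ hz.1
  refine ⟨hy, fun i => ?_⟩
  obtain ⟨h1, h2⟩ := hz.2 i
  have hU := abs_ev_le_of (U i) hy
  have hV := abs_ev_le_of (V i) hy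
  have hR0 : 0 ≤ R := (abs_nonneg _).trans hy
  rw [abs_le] at hU hV ⊢
  constructor <;> nlinarith [abs_nonneg ((U i).1 (Fin.last 0) : ℝ), abs_nonneg ((V i).1 (Fin.last 0) : ℝ),
    abs_nonneg ((U i).2 : ℝ), abs_nonneg ((V i).2 : ℝ)]

/-- **A product domain over a bounded base cell is bounded.** [folklore] -/
theorem isBounded_pDom {m' : ℕ} (M : Fin m' → Cf) (U V : Fin k → Cf) {R : ℝ}
    (hR : ∀ y ∈ cell M, |y| ≤ R) : Bornology.IsBounded (pDom M U V) := by
  set B : Fin k → ℝ := fun i => (|((U i).1 (Fin.last 0) : ℝ)| + |((V i).1 (Fin.last 0) : ℝ)|) * R +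
      (|((U i).2 : ℝ)| + |((V i).2 : ℝ)|) with hB
  refine IntegrateOutLow.isBounded_of_forall_abs_le (R + ∑ i, B i) fun z hz l => ?_
  obtain ⟨hy, ht⟩ := abs_le_of_mem_pDom M U V hR hz
  have hR0 : 0 ≤ R := (abs_nonneg _).trans hy
  have hB0 : ∀ i, 0 ≤ B i := fun i => add_nonneg (mul_nonneg (by positivity) hR0) (by positivity)
  have hsum : 0 ≤ ∑ i, B i := Finset.sum_nonneg fun i _ => hB0 i
  rcases idx_cases l with rfl | ⟨i, rfl⟩
  · exact hy.trans (le_add_of_nonneg_right hsum)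
  · have h1 : |tv z i| ≤ B i := ht i
    have h2 : B i ≤ ∑ j, B j := Finset.single_le_sum (fun j _ => hB0 j) (Finset.mem_univ i)
    exact (h1.trans h2).trans (le_add_of_nonneg_left hR0)

/-- The domain of a product representation is bounded. [folklore] -/
theorem IsProd.bdd {s : KZ.IntegralRep (0 + 1 + k)} {m' : ℕ} {M : Fin m' → Cf} {U V : Fin k → Cf}
    {T : BData} {p : MvPolynomial (Fin 0) ℚ} {a : Fin k → Option Cf} (h : IsProd s M U V T p a) :
    Bornology.IsBounded s.domain := by
  obtain ⟨R, hR⟩ := h.cbd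
  rw [h.dom]
  exact isBounded_pDom M U V hR

/-- Restricting a product representation to a product sub-domain with more rows. [folklore] -/
theorem IsProd.restrict {s : KZ.IntegralRep (0 + 1 + k)} {m' m'' : ℕ} {M : Fin m' → Cf}
    {U V : Fin k → Cf} {T : BData} {p : MvPolynomial (Fin 0) ℚ} {a : Fin k → Option Cf}
    (h : IsProd s M U V T p a) (M' : Fin m'' → Cf) (U' V' : Fin k → Cf)
    (hsub : pDom M' U' V' ⊆ s.domain) (hcell : cell M' ⊆ cell M) :
    IsProd (s.restrict _ (isSemialgebraic_pDom M' U' V') hsub) M' U' V' T p a := by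
  obtain ⟨R, hR⟩ := h.cbd
  exact ⟨rfl, fun _ hz => h.int (hsub hz), h.adm, ⟨R, fun y hy => hR y (hcell hy)⟩⟩

/-! ### The target -/

/-- Elements of `GG 0 2 k` are good. [folklore] -/
theorem good_of_mem {x : KZ.FormalRep} (h : x ∈ GGset 0 2 k) : Good k x :=
  ⟨x, AddSubgroup.subset_closure h, by simp⟩

/-- Relations are good. [folklore] -/
theorem good_of_mem_relations {x : KZ.FormalRep} (h : x ∈ KZ.relations) : Good k x :=
  ⟨0, zero_mem _, by simpa using h⟩

/-- Goodness passes along relations. [folklore] -/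
theorem good_of_sub_mem {x y : KZ.FormalRep} (h : x - y ∈ KZ.relations) (hy : Good k y) :
    Good k x := by
  obtain ⟨c, hc, hyc⟩ := hy
  refine ⟨c, hc, ?_⟩
  have := add_mem h hyc
  rwa [sub_add_sub_cancel] at this

/-- Sums of good elements are good. [folklore] -/
theorem Good.add {x y : KZ.FormalRep} (hx : Good k x) (hy : Good k y) : Good k (x + y) := by
  obtain ⟨c, hc, hxc⟩ := hx
  obtain ⟨d, hd, hyd⟩ := hy
  refine ⟨c + d, add_mem hc hd, ?_⟩
  have := add_mem hxc hyd
  rwa [show x - c + (y - d) = x + y - (c + d) by abel] at this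

/-- Differences of good elements are good. [folklore] -/
theorem Good.sub {x y : KZ.FormalRep} (hx : Good k x) (hy : Good k y) : Good k (x - y) := by
  obtain ⟨c, hc, hxc⟩ := hx
  obtain ⟨d, hd, hyd⟩ := hy
  refine ⟨c - d, sub_mem hc hd, ?_⟩
  have := sub_mem hxc hyd
  rwa [show x - c - (y - d) = x - y - (c - d) by abel] at this

/-- Goodness from a three-term relation `[s] − [s₁] − [s₂] ∈ relations`. [folklore] -/
theorem good_of_rel3 {x y w : KZ.FormalRep} (h : x - y - w ∈ KZ.relations) (hy : Good k y)
    (hw : Good k w) : Good k x :=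
  good_of_sub_mem (by rwa [sub_add_eq_sub_sub]) (hy.add hw)

/-- Goodness from a Janus extension `[T] − [s] − [W] ∈ relations`. [folklore] -/
theorem good_of_janus {x t w : KZ.FormalRep} (h : t - x - w ∈ KZ.relations) (ht : Good k t)
    (hw : Good k w) : Good k x := by
  refine good_of_sub_mem ?_ (ht.sub hw)
  have := KZ.relations.neg_mem h
  rwa [show -(t - x - w) = x - (t - w) by abel] at this

/-! ### The format -/

/-- **Packaging.** A product representation all of whose fibres are in format is good (it is an
element of the literal class `GG 0 2 k`). -/
theorem good_of_allFmt {s : KZ.IntegralRep (0 + 1 + k)} {m' : ℕ} {M : Fin m' → Cf}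
    {U V : Fin k → Cf} {T : BData} {p : MvPolynomial (Fin 0) ℚ} {a : Fin k → Option Cf}
    (h : IsProd s M U V T p a) (hf : ∀ j, InFmt (a j) (U j) (V j)) : Good k (KZ.of s) := by
  refine good_of_mem (mem_GGset_two s M T.L T.e p T.ℓ₁ T.ℓ₂ a _ _ h.adm (fun i c hc => (hf i).1 c hc)
    (fun i c hc => ?_) h.bdd h.dom h.int)
  rcases hc with hc | hc <;> simp only [Sum.inr.injEq] at hc <;> subst hc
  · exact (hf i).2.1
  · exact (hf i).2.2

/-- The continuation hypothesis only sees the spectator fibres. [folklore] -/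
theorem HP.transfer {T : BData} {i : Fin k} {U V U' V' : Fin k → Cf} {a a' : Fin k → Option Cf}
    (hP : HP T i U V a) (hsame : ∀ j, j ≠ i → a' j = a j ∧ U' j = U j ∧ V' j = V j) :
    HP T i U' V' a' := fun m' s M U'' V'' p a'' h hf hs =>
  hP m' s M U'' V'' p a'' h hf fun j hj => by
    obtain ⟨h1, h2, h3⟩ := hs j hj
    obtain ⟨h1', h2', h3'⟩ := hsame j hj
    exact ⟨h1.trans h1', h2.trans h2', h3.trans h3'⟩

/-- Updating fibre `i` only does not touch the spectators. [folklore] -/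
theorem same_update (i : Fin k) (U V : Fin k → Cf) (a : Fin k → Option Cf) (u v : Cf)
    (c : Option Cf) : ∀ j, j ≠ i → Function.update a i c j = a j ∧
      Function.update U i u j = U j ∧ Function.update V i v j = V j := fun j hj => by
  simp [Function.update_of_ne hj]

end RebaseZero

/-- Registered support goal of this file: a product domain over a bounded base cell is bounded. -/
theorem rebaseSimpleZeroProduct_isBounded_pDom (k m' : ℕ) (M : Fin m' → (Fin (0 + 1) → ℚ) × ℚ) (U V : Fin k → (Fin (0 + 1) → ℚ) × ℚ) (R : ℝ) (hR : ∀ y ∈ RebaseZero.cell M, |y| ≤ R) : Bornology.IsBounded (RebaseZero.pDom M U V) :=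
  RebaseZero.isBounded_pDom M U V hR

end Summit.KontsevichZagierPeriods.ArrangementNormalForm.JanusBands
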